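import Literature.Analysis.FluidPDE.PassiveScalar
import Literature.Analysis.FunctionSpaces.HolderNorm
import Mathlib.Analysis.SpecialFunctions.Log.Basic
import Mathlib.Analysis.Normed.Group.AddCircle
import HarnessLib

/-!
# Anomalous dissipation of all smooth data by alternating shears, uniformly-in-time Hölder
# velocities, and the sharpness of the Obukhov–Corrsin threshold (Elgindi–Liss 2024)

T. M. Elgindi, K. Liss, *Norm growth, non-uniqueness, and anomalous dissipation in passive
scalars*, Arch. Ration. Mech. Anal. **248** (2024), no. 6, Paper No. 120 = arXiv:2309.08576 (v1,
the only arXiv version; page numbers below are those of the arXiv PDF). [`ElgindiLiss2024`]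

The setting is the advection–diffusion equation `∂ₜf^κ + u·∇f^κ = κΔf^κ`, `f^κ(0) = f₀` ((1) p. 1)
on `𝕋² = ℝ²/(2πℤ²)` with a divergence-free drift `u`, the dissipation
`𝓔_κ(t) := 2κ∫₀ᵗ‖∇f^κ(s)‖²_{L²} ds` ((2) p. 1) and "anomalous dissipation:
`liminf_{κ→0} 𝓔_κ(t) = c₀ > 0` for some `t > 0`" ((3) p. 2). The velocity fields are ALTERNATING
SAWTOOTH SHEARS `H_{α,N} = (α S(Ny), 0)`, `V_{α,N} = (0, α S(Nx))`, `S(x) = |x|` on `[-π,π)`, run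
with smooth time envelopes `ψ((t - T_{j-1})/t_j)`, `ψ ∈ C_c^∞((0,1))`, `∫ψ = 1`, along frequencies
`N_j = 2^j`, amplitudes `α_j = 2^{-j}(1 + j⁴(log 2)⁴)` and durations `t_j = 2⌈Mj^{5/2}⌉/(α_jN_j)`
(§2.2 pp. 8–9; `K_j := α_jN_jt_j`, the `H¹` norm of every transported mean-zero datum being
amplified by `≍ K_j²` over the `j`-th phase, Lemma 2.2 p. 10), and the mechanism is the inviscid
criterion Prop. 2.1 p. 8 (Drivas–Elgindi–Iyer–Jeong's Prop. 1.3 with `H²` replaced by `H^σ`,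
`σ ∈ (1,2]`; the `σ = 2` form is PROVED in the tree as
`Torus.DEIJ.le_eScalarDissipation_of_balanced_growth`, `DEIJCriterion.lean`): unbounded cumulative
enstrophy plus balanced growth of the transport solution force `κ∫₀ᵀ‖∇f^κ‖² ≥ χ‖f₀‖²` for every
`κ ∈ (0,1)`.

## What is typed (statement-first; two named facts over two clause predicates; non-vacuity of
`IsUniformCarrier` checked on the zero field in a scratch file, not shipped)

* `ElgindiLiss2024.DissipatesAllSmoothData T u` — "for every mean-zero and smooth initial data
  `f₀`, the solutions `f^κ` exhibit anomalous dissipation on `[0,T]`" ((3) with `t = T`): for every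
  smooth mean-zero `f₀` there is `c = c(f₀) > 0` (Remark 1.2 p. 3: the dissipated amount depends on
  `f₀` through `‖f₀‖_{W^{1,∞}}/‖f₀‖_{L²}` and `‖f₀‖^s_{L²}‖f₀‖_{Ḣ^{1+s}}/‖f₀‖^{1+s}_{H¹}`) such that
  along every sequence `κ_j → 0⁺` and for all weak solutions `f_j` with diffusivity `κ_j` and datum
  `f₀` on `[0,T)`, eventually `c‖f₀‖²_{L²} ≤ κ_j∫₀ᵀ‖∇f_j‖²` — i.e. `liminf_{κ→0⁺} κ∫₀ᵀ‖∇f^κ‖² > 0`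
  (the same sequence form as `deij_anomalous_dissipation_eventually`; the proof, §2.5 p. 18 via
  Prop. 2.1, gives the bound for every `κ ∈ (0,1)`, which implies it; for these bounded
  divergence-free drifts the weak solution is unique, so quantifying over all weak solutions
  `Torus.IsWeakScalarTransportOn` renders the paper's `f^κ`).
* `ElgindiLiss2024.IsUniformCarrier T u` — the velocity class of Thm. 1: weakly divergence free at
  every `t ∈ [0,T]`, `u ∈ C⁰([0,T]; C^{0,α}(𝕋²))` for EVERY `α < 1`
  (`FunctionSpaces.ContinuousInHolderOn (Icc 0 T) α u`, `0 < α < 1`), and the uniform log-Lipschitz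
  modulus (4) p. 2: `|u(t,z) - u(t,z')| ≤ C ω(|z - z'|)`, `ω(s) = s(1 + |log s|⁴)` (`ElgindiLiss2024.omega`).
* **`ElgindiLiss2024_thm1`** (Thm. 1 p. 2): for every `T > 0` such a `u` exists with
  `DissipatesAllSmoothData T u`.
* **`ElgindiLiss2024_thm2`** (Thm. 2 p. 3): for every `T > 0`, `α ∈ (0,1)` and `0 ≤ β < (1-α)/2`
  there is a divergence-free `u ∈ C([0,T]; C^{0,α}(𝕋²))` with `DissipatesAllSmoothData T u` AND,
  for every smooth mean-zero `f₀`, a bound `‖f^κ‖_{L²([0,T]; C^{0,β}(𝕋²))} ≤ B(f₀)` uniform over the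
  small diffusivities ((6) p. 3; `FunctionSpaces.eLpHolderNorm 2 β`): the scalars get arbitrarily
  close to the Obukhov–Corrsin threshold `β ≤ (1-α)/2` ((5) p. 3), whose rigid side — no anomalous
  dissipation when `u ∈ L^∞_tC^α_x` and `sup_κ ‖f^κ‖_{L²_tC^β} < ∞` with `β > (1-α)/2` — is the
  tree's PROVED `Barriers.AnomalousDissipation.DrivasElgindiIyerJeong2022_thm4_timeIntegrated`
  (module `ObukhovCorrsinThresholdTimeIntegrated`), which cites the present Thm. 2 as its flexible
  side.

## The forward–backward `H¹`-growth lemmas of §2.3 (appended 2026-08-27)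

The mechanism behind Thm. 1 at the discrete times `T_j` is PDE-free: with the Lebesgue-measure
preserving sawtooth shears `φ_j(x,y) = (x + α_jt_j S(N_jy), y)`, `ψ_j(x,y) = (x, y + t_jα_j S(N_jx))`,
`Φ_j = ψ_j ∘ φ_j` (§2.3 p. 9) the transported scalar at time `T_j` is
`f_j = f₀ ∘ Φ_1⁻¹ ∘ ⋯ ∘ Φ_j⁻¹` (p. 9), and
* **Lemma 2.3** (p. 10, (16)–(17)): there are `c, C > 0` such that, for `M` large, every mean-zero
  `g ∈ H¹` and every `j ∈ ℕ` satisfy `‖g∘Φ_{j+1}⁻¹‖²_{Ḣ¹} + ‖g∘Φ_j‖²_{Ḣ¹} ≥ cK_j⁴‖g‖²_{Ḣ¹}` and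
  `‖g∘Φ_{j+2}⁻¹‖²_{Ḣ¹} + ‖g∘Φ_{j+2}‖²_{Ḣ¹} ≥ (K_{j+2}⁴ - CK_{j+2}³)‖g‖²_{Ḣ¹}` — forward–backward
  growth by the factor `K_j²` per phase for EVERY function, cancellations notwithstanding;
* **Lemma 2.4** (p. 12): for `M` large and every mean-zero `f₀ ∈ H¹`,
  `‖f_j‖_{Ḣ¹} ≥ c‖f₀‖_{Ḣ¹}∏_{n=1}^{j}K_n²` with `c` depending only on an upper bound for
  `‖f₀‖_{Ḣ¹}/‖f₀‖_{L²}` (and on the fixed `M`, through `∏_{j ≤ ⌈log‖f₀‖_{Ḣ¹}⌉+2} K_j⁴`, proof p. 13).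
These are typed below as `ElgindiLiss2024_lem23` / `ElgindiLiss2024_lem24` over the explicit maps
on the unit torus (`ElgindiLiss2024.shearH/shearV/phiMap/psiMap/PhiMap/PhiInv/flowInv`, the
parameters `freq j = N_j = 2^j`, `amp j = α_j = 2^{-j}(1 + j⁴(log 2)⁴)`,
`growthFactor M j = K_j = 2⌈Mj^{5/2}⌉`, `dur M j = t_j = K_j/(α_jN_j)`, §2.2.2 p. 9). Under the
rescaling `x = 2πx'` of item 3. below, `S(N·2πy')/(2π) = ‖N • y'‖` (the distance to `0` in
`ℝ/ℤ`), so `φ_j` becomes `(x', y') ↦ (x' + α_jt_j‖N_j • y'‖, y')` with the SAME slope `±K_j`; the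
`Ḣ¹` seminorms of both sides of each inequality scale identically, so the constants are those of
the paper. `‖·‖²_{Ḣ¹} = Torus.eScalarGradNormSq` (spectral, `ℝ≥0∞`).

## Recorded weakenings / what is not transcribed (nothing silent)

1. Time regularity. Thm. 1 prints `u ∈ C^∞([0,T]; C^α(𝕋²)) ∀ α ∈ (0,1)` ((1.2)/(3')): smooth as a
   `C^α`-valued map of time, up to and including the accumulation time `T`. The tree has no
   vocabulary for `C^k_t` with values in a Hölder space; typed is `C⁰([0,T]; C^{0,α})` for every
   `α < 1` (WEAKER; the content "no loss of spatial regularity at any instant, in contrast with the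
   final-time-singular field of DEIJ Thm. 2" is retained).
2. Non-uniqueness. "Solutions to the corresponding transport equation are non-unique" (Thm. 1) is
   NOT transcribed: the printed proof (§2.5 p. 18) establishes it "for a suitably modified velocity
   field … as in [DEIJ22]" and the class of weak solutions meant is not specified on the page.
3. Torus normalisation. The paper's torus is `ℝ²/(2πℤ²)`; the tree's is the unit torus
   `UnitAddTorus (Fin 2)`. Under `x = 2πy`, `ũ(t,y) = u(t,2πy)/(2π)`, `κ̃ = κ/(4π²)` the equation,
   Hölder classes, the modulus `ω` (up to the constant `C`) and the dissipated FRACTION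
   `κ∫‖∇f^κ‖²/‖f₀‖²` are invariant, so Thm. 1 transcribes verbatim; in Thm. 2 the printed
   `sup_{κ ∈ [0,1]}` becomes `κ̃ ∈ [0, 1/(4π²)]`, typed as "for all `κ ∈ (0, κ₀]` for some `κ₀ > 0`"
   (WEAKER) with `κ = 0` (the transport solution) omitted (WEAKER).
4. The modulus constant: "`C > 0` a universal constant" — typed `∃ C` for each `T` (the reduction to
   the construction's own terminal time `T_*` rescales `u` by `T_*/T`, §2.2 p. 8) (WEAKER).
5. Data: typed for smooth mean-zero data as printed; Remark 1.2 (`f₀ ∈ H^{1+s} ∩ W^{1,∞}`,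
   `s > 2/5`) and Remark 1.3 (lift to `𝕋^d`, `d ≥ 2`) are not typed; Remark 1.4 (the field solves
   forced 2D Euler with a `C^∞_tC^α_x` force; a `2½`-dimensional Navier–Stokes example) is prose.
6. `0 < α` in Thm. 2 as printed (`α ∈ (0,1)`); `β ≥ 0` as in the proof (§2.6 p. 19: "Fix
   `α ∈ (0,1)` and `0 ≤ β < (1-α)/2`").
7. Lemma 2.4: `c` is allowed to depend on `M` as well as on the ratio bound (`∀ M ≥ M₀, ∀ R, ∃ c`;
   WEAKER than a literal reading of "depending only on an upper bound for `‖f₀‖_{Ḣ¹}/‖f₀‖_{L²}`",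
   and what the proof gives, p. 13); `j ∈ ℕ = {1, 2, …}` as printed (`1 ≤ j`); the ratio class is
   written `‖∇f₀‖² ≤ R‖f₀‖²` as in `armstrong_vicol`. Lemma 2.2 (continuous-time growth with the
   profile `h_j(t)`, (13)–(14) p. 10) and (15) (`∫₀^{T_*}‖∇f‖² = ∞`) concern the transport PDE and
   are not typed here; nor is the choice of the envelope `ψ` (irrelevant at the discrete times).

presearch (2026-08-27): `lean search ElgindiLiss` — cited in `TurbPassiveScalar.lean` (comparison
only), `DEIJCriterion.lean` (Prop. 2.1, `σ = 2`, proved form) and the Obukhov–Corrsin barrier files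
(`[cite: ElgindiLiss2024, Thm. 2]` as the flexible side); no typed statement of Thm. 1 / Thm. 2
before this file. Held text: `paper:arxiv-2309.08576` (TeX) + arXiv PDF render for page numbers.

## References

* T. M. Elgindi, K. Liss, *Norm growth, non-uniqueness, and anomalous dissipation in passive
  scalars*, Arch. Ration. Mech. Anal. 248 (2024), Paper No. 120, doi:10.1007/s00205-024-02056-x;
  arXiv:2309.08576v1: Thm. 1 and (3)–(4) p. 2, Remarks 1.1–1.4 pp. 2–3, Thm. 2 and (5)–(6) p. 3,
  Prop. 2.1 p. 8, §2.2 pp. 8–9 ((11), `K_j` p. 9), §2.3 p. 9 (`φ_j, ψ_j, Φ_j, f_j`), Lemma 2.2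
  p. 10, Lemma 2.3 (16)–(17) p. 10 (proof pp. 11–12), Lemma 2.4 p. 12 (proof pp. 12–13), §2.5
  p. 18, §2.6 pp. 19–20. [`ElgindiLiss2024`]
* T. D. Drivas, T. M. Elgindi, G. Iyer, I.-J. Jeong, *Anomalous dissipation in passive scalar
  transport*, Arch. Ration. Mech. Anal. 243 (2022) — Thm. 2 (`deij_anomalous_dissipation`),
  Prop. 1.3, Thm. 4 (the Obukhov–Corrsin barrier). [`DrivasEtAl2022`]
-/

open MeasureTheory Set Filter Topology
open scoped ENNReal NNReal

noncomputable section

namespace Literature.Analysis.FluidPDE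

namespace ElgindiLiss2024

/-- The log-Lipschitz modulus of continuity `ω(s) = s (1 + |log s|⁴)` of Elgindi–Liss's velocity
field ((4) p. 2; Remark 1.1: the power `4` can be any `p > 3`). (`Real.log 0 = 0`, so `ω(0) = 0`.)
[cite: ElgindiLiss2024, Thm. 1 (4) p. 2] -/
def omega (s : ℝ) : ℝ := s * (1 + |Real.log s| ^ 4)

/-- **"For every mean-zero and smooth initial data `f₀`, the solutions `f^κ` exhibit anomalous
dissipation on `[0,T]`"** (Elgindi–Liss, Thm. 1 / Thm. 2 with (3) p. 2 at `t = T`), for a drift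
`u` on the unit torus `𝕋²`: for every smooth mean-zero `f₀ : 𝕋² → ℝ` there is `c = c(f₀) > 0`
such that for every sequence of diffusivities `κⱼ > 0`, `κⱼ → 0`, and all weak solutions `fⱼ` of
`∂ₜf + u·∇f = κⱼΔf`, `f(0) = f₀` on `[0,T)`, eventually `c ‖f₀‖²_{L²} ≤ κⱼ ∫₀ᵀ ‖∇fⱼ(t)‖²_{L²} dt`
— equivalently `liminf_{κ→0⁺} κ∫₀ᵀ‖∇f^κ‖² ≥ c‖f₀‖² > 0` for `f₀ ≠ 0`. (The proof, §2.5 p. 18 via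
Prop. 2.1 p. 8, gives the bound for every `κ ∈ (0,1)` in the paper's normalisation; the dissipated
fraction `c` depends on `f₀`, Remark 1.2 p. 3. `‖f₀‖²_{L²} = Torus.scalarL2Sq f₀`,
`κ∫₀ᵀ‖∇f‖² = Torus.eScalarDissipation κ f 0 T`.)
[cite: ElgindiLiss2024, Thm. 1 p. 2 with (3) p. 2; Remark 1.2 p. 3; §2.5 p. 18] -/
def DissipatesAllSmoothData (T : ℝ)
    (u : ℝ → UnitAddTorus (Fin 2) → EuclideanSpace ℝ (Fin 2)) : Prop :=
  ∀ f₀ : UnitAddTorus (Fin 2) → ℝ, FunctionSpaces.Torus.IsSmooth f₀ →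
    FunctionSpaces.Torus.HasZeroMean f₀ →
    ∃ c : ℝ, 0 < c ∧
      ∀ κ : ℕ → ℝ, (∀ j, 0 < κ j) → Tendsto κ atTop (𝓝 0) →
        ∀ f : ℕ → ℝ → UnitAddTorus (Fin 2) → ℝ,
          (∀ j, Torus.IsWeakScalarTransportOn T (κ j) u f₀ (f j)) →
          ∀ᶠ j in atTop,
            ENNReal.ofReal (c * Torus.scalarL2Sq f₀) ≤ Torus.eScalarDissipation (κ j) (f j) 0 T

/-- **The velocity class of Elgindi–Liss's Thm. 1** on `[0,T] × 𝕋²` (unit torus): weakly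
divergence free at every `t ∈ [0,T]` (the fields are Lipschitz shears at each instant), continuous
on `[0,T]` with values in `C^{0,α}(𝕋²)` for EVERY `α < 1` — the printed `u ∈ C^∞([0,T]; C^α(𝕋²))`
`∀ α ∈ (0,1)` is smooth in time as a `C^α`-valued map; typed is `C⁰` in time (weaker, see the module
docstring 1.) — and obeying the uniform log-Lipschitz bound (4):
`|u(t,z) - u(t,z')| ≤ C ω(|z - z'|)` for all `t ∈ [0,T]`, `z, z' ∈ 𝕋²`, `ω(s) = s(1 + |log s|⁴)`,
for some constant `C` (printed: "a universal constant"; here `∃ C`, module docstring 4.).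
[cite: ElgindiLiss2024, Thm. 1 (4) p. 2; §2.2 (the sufficient condition for the regularity) p. 8] -/
def IsUniformCarrier (T : ℝ) (u : ℝ → UnitAddTorus (Fin 2) → EuclideanSpace ℝ (Fin 2)) : Prop :=
  (∀ t ∈ Icc 0 T, FunctionSpaces.Torus.IsWeaklyDivFree (u t)) ∧
    (∀ α : ℝ≥0, 0 < α → α < 1 → FunctionSpaces.ContinuousInHolderOn (Icc 0 T) α u) ∧
    ∃ C : ℝ, ∀ t ∈ Icc 0 T, ∀ z z' : UnitAddTorus (Fin 2),
      ‖u t z - u t z'‖ ≤ C * omega (dist z z')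

end ElgindiLiss2024

/-- **Elgindi–Liss 2024, Theorem 1** (anomalous dissipation of ALL smooth data under a velocity
field uniformly `C^α` in time for every `α < 1`). "Fix `T > 0`. There exists a divergence-free
velocity field `u : [0,T] × 𝕋² → ℝ²` with `u ∈ C^∞([0,T]; C^α(𝕋²)) ∀ α ∈ (0,1)` such that, for
every mean-zero and smooth initial data `f₀`, the solutions `f^κ` exhibit anomalous dissipation on
`[0,T]`. Solutions to the corresponding transport equation are non-unique while `u` satisfies
`|u(t,z) - u(t,z')| ≤ C ω(|z - z'|)` (4) for all `t ∈ [0,T]` and `z, z' ∈ 𝕋²`, with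
`ω(s) = s(1 + |log(s)|⁴)` and `C > 0` a universal constant." Typed: for every `T > 0` there is
`u` with `ElgindiLiss2024.IsUniformCarrier T u` (div-free, `C⁰([0,T]; C^{0,α})` for every `α < 1`
— WEAKER than the printed `C^∞` in time —, log-Lipschitz (4)) and
`ElgindiLiss2024.DissipatesAllSmoothData T u`; the non-uniqueness clause is not transcribed (module
docstring 2.); unit-torus normalisation (module docstring 3.). The field is the alternating
sawtooth-shear cascade of §2.2 (pp. 8–9) and the datum-by-datum mechanism is Lemma 2.2 (`H¹`
growth by `K_j²` per phase, p. 10) + Prop. 2.1 (p. 8).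
[cite: ElgindiLiss2024, Thm. 1 p. 2] -/
def ElgindiLiss2024_thm1 : Prop :=
  ∀ T : ℝ, 0 < T →
    ∃ u : ℝ → UnitAddTorus (Fin 2) → EuclideanSpace ℝ (Fin 2),
      ElgindiLiss2024.IsUniformCarrier T u ∧ ElgindiLiss2024.DissipatesAllSmoothData T u

/-- **Elgindi–Liss 2024, Theorem 2** (sharpness of the Obukhov–Corrsin threshold at the
`L^∞_tC^α_x × L²_tC^β_x` corner, every `α ∈ (0,1)`). "Fix `T > 0`, `α ∈ (0,1)`, and
`β < (1-α)/2`. There exists a divergence-free velocity field `u : [0,T] × 𝕋² → ℝ²` with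
`u ∈ C([0,T]; C^α(𝕋²))` such that for every mean-zero `f₀ ∈ C^∞(𝕋²)` the solutions `f^κ` of (1)
exhibit anomalous dissipation on `[0,T]` and satisfy `sup_{κ ∈ [0,1]} ‖f^κ‖_{L²([0,T];C^β(𝕋²))} < ∞`.
(6)" Typed (unit torus `𝕋² = UnitAddTorus (Fin 2)`): for `T > 0`, `0 < α < 1` and `β : ℝ≥0` with
`β < (1-α)/2` (`β ≥ 0` as in the proof, §2.6 p. 19) there is `u`, weakly divergence free at every
`t ∈ [0,T]`, with `FunctionSpaces.ContinuousInHolderOn (Icc 0 T) α u`,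
`ElgindiLiss2024.DissipatesAllSmoothData T u`, and for every smooth mean-zero `f₀` constants
`κ₀ > 0`, `B` such that for every diffusivity `κ ∈ (0, κ₀]` the problem with datum `f₀` on `[0,T)`
has a weak solution `f` (the unique one, `u` being bounded and divergence free) lying in
`L²((0,T); C^{0,β}(𝕋²))` with `‖f‖_{L²((0,T); C^{0,β})} ≤ B` (`FunctionSpaces.MemLpHolder 2 β f
(Ioo 0 T)`, `FunctionSpaces.eLpHolderNorm 2 β f (Ioo 0 T) ≤ B`; stated for a version of the
solution because the Hölder norm of a time slice is representative-dependent).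
WEAKER than print in: `κ ∈ (0, κ₀]` for some `κ₀ > 0` instead of the printed `κ ∈ [0,1]` of
`ℝ²/(2πℤ²)` (`= [0, 1/(4π²)]` in unit-torus units), and `κ = 0` omitted (module docstring 3.). The
rigid side of the threshold (5) p. 3 is the tree's proved
`Barriers.AnomalousDissipation.DrivasElgindiIyerJeong2022_thm4_timeIntegrated`.
[cite: ElgindiLiss2024, Thm. 2 (6) p. 3; §2.6 pp. 19–20] -/
def ElgindiLiss2024_thm2 : Prop :=
  ∀ T : ℝ, 0 < T → ∀ α : ℝ≥0, 0 < α → α < 1 → ∀ β : ℝ≥0, (β : ℝ) < (1 - α) / 2 →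
    ∃ u : ℝ → UnitAddTorus (Fin 2) → EuclideanSpace ℝ (Fin 2),
      (∀ t ∈ Icc 0 T, FunctionSpaces.Torus.IsWeaklyDivFree (u t)) ∧
      FunctionSpaces.ContinuousInHolderOn (Icc 0 T) α u ∧
      ElgindiLiss2024.DissipatesAllSmoothData T u ∧
      ∀ f₀ : UnitAddTorus (Fin 2) → ℝ, FunctionSpaces.Torus.IsSmooth f₀ →
        FunctionSpaces.Torus.HasZeroMean f₀ →
        ∃ κ₀ : ℝ, 0 < κ₀ ∧ ∃ B : ℝ≥0, ∀ κ : ℝ, 0 < κ → κ ≤ κ₀ →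
          ∃ f : ℝ → UnitAddTorus (Fin 2) → ℝ, Torus.IsWeakScalarTransportOn T κ u f₀ f ∧
            FunctionSpaces.MemLpHolder 2 β f (Ioo 0 T) ∧
            FunctionSpaces.eLpHolderNorm 2 β f (Ioo 0 T) ≤ B

/-! ## §2.3: the sawtooth shear maps and the forward–backward `H¹`-growth lemmas -/

namespace ElgindiLiss2024

/-- The horizontal sawtooth shear `(x, y) ↦ (x + a S̃(N y), y)` of the unit torus
`𝕋² = (Fin 2 → ℝ/ℤ)`, `S̃(η) = ‖η‖ = dist(η, 0) ∈ [0, ½]` — Elgindi–Liss's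
`φ = (x + a S(Ny), y)`, `S(x) = |x|` on `[-π,π)`, after `x = 2πx'` (`S(N·2πη)/(2π) = ‖N • η‖`);
Lebesgue-measure preserving, piecewise affine with slopes `±aN`, inverse `shearH (-a) N`.
[cite: ElgindiLiss2024, §2.2.1 (H_{α,N}) p. 8 and §2.3 (φ_j) p. 9] -/
def shearH (a : ℝ) (N : ℕ) (z : UnitAddTorus (Fin 2)) : UnitAddTorus (Fin 2) :=
  Function.update z 0 (z 0 + ((a * ‖N • z 1‖ : ℝ) : UnitAddCircle))

/-- The vertical sawtooth shear `(x, y) ↦ (x, y + a S̃(N x))` (Elgindi–Liss's `ψ = (x, y + aS(Nx))`,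
unit-torus form; inverse `shearV (-a) N`).
[cite: ElgindiLiss2024, §2.2.1 (V_{α,N}) p. 8 and §2.3 (ψ_j) p. 9] -/
def shearV (a : ℝ) (N : ℕ) (z : UnitAddTorus (Fin 2)) : UnitAddTorus (Fin 2) :=
  Function.update z 1 (z 1 + ((a * ‖N • z 0‖ : ℝ) : UnitAddCircle))

/-- The frequencies `N_j = 2^j`. [cite: ElgindiLiss2024, §2.2.2 p. 9] -/
def freq (j : ℕ) : ℕ := 2 ^ j

/-- The amplitudes `α_j = 2^{-j}(1 + |log N_j|⁴) = 2^{-j}(1 + j⁴|log 2|⁴)`.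
[cite: ElgindiLiss2024, §2.2.2 p. 9] -/
def amp (j : ℕ) : ℝ := (1 / 2 ^ j) * (1 + (j : ℝ) ^ 4 * |Real.log 2| ^ 4)

/-- The growth factors `K_j := α_jN_jt_j = 2⌈Mj^{5/2}⌉` (`M ≥ 2` a large parameter); the `H¹` norm
of a transported scalar is amplified by `≍ K_j²` over the `j`-th phase.
[cite: ElgindiLiss2024, §2.2.2 p. 9 (K_j) and §2.3 p. 10] -/
def growthFactor (M : ℝ) (j : ℕ) : ℝ := 2 * (⌈M * (j : ℝ) ^ (5 / 2 : ℝ)⌉₊ : ℝ)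

/-- The phase durations `t_j = 2⌈Mj^{5/2}⌉/(α_jN_j)` (so that `α_jN_jt_j = K_j`).
[cite: ElgindiLiss2024, §2.2.2 p. 9] -/
def dur (M : ℝ) (j : ℕ) : ℝ := growthFactor M j / (amp j * freq j)

/-- `φ_j(x,y) = (x + α_jt_j S(N_jy), y)` (unit-torus form; shift amplitude `α_jt_j = K_j/N_j`).
[cite: ElgindiLiss2024, §2.3 p. 9] -/
def phiMap (M : ℝ) (j : ℕ) : UnitAddTorus (Fin 2) → UnitAddTorus (Fin 2) :=
  shearH (amp j * dur M j) (freq j)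

/-- `ψ_j(x,y) = (x, y + t_jα_j S(N_jx))` (unit-torus form). [cite: ElgindiLiss2024, §2.3 p. 9] -/
def psiMap (M : ℝ) (j : ℕ) : UnitAddTorus (Fin 2) → UnitAddTorus (Fin 2) :=
  shearV (amp j * dur M j) (freq j)

/-- `Φ_j = ψ_j ∘ φ_j`, the flow map of the `j`-th phase (one `H` pulse then one `V` pulse).
[cite: ElgindiLiss2024, §2.3 p. 9] -/
def PhiMap (M : ℝ) (j : ℕ) : UnitAddTorus (Fin 2) → UnitAddTorus (Fin 2) :=
  psiMap M j ∘ phiMap M j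

/-- `Φ_j⁻¹ = φ_j⁻¹ ∘ ψ_j⁻¹` (the shears are inverted by reversing the sign of the amplitude).
[cite: ElgindiLiss2024, §2.3 p. 9] -/
def PhiInv (M : ℝ) (j : ℕ) : UnitAddTorus (Fin 2) → UnitAddTorus (Fin 2) :=
  shearH (-(amp j * dur M j)) (freq j) ∘ shearV (-(amp j * dur M j)) (freq j)

/-- The inverse flow after `j` phases, `Φ_1⁻¹ ∘ Φ_2⁻¹ ∘ ⋯ ∘ Φ_j⁻¹` (identity for `j = 0`), so that
the transported scalar at time `T_j` is `f_j = f₀ ∘ flowInv M j` ("`f_j = f₀ ∘ Φ_1⁻¹ ∘ ⋯ ∘ Φ_j⁻¹`",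
p. 9); written with the recursor: `flowInv M (j+1) = flowInv M j ∘ Φ_{j+1}⁻¹`.
[cite: ElgindiLiss2024, §2.3 p. 9] -/
def flowInv (M : ℝ) (j : ℕ) : UnitAddTorus (Fin 2) → UnitAddTorus (Fin 2) :=
  Nat.rec id (fun k F => F ∘ PhiInv M (k + 1)) j

end ElgindiLiss2024

/-- **Elgindi–Liss 2024, Lemma 2.3** (forward–backward `H¹` growth under one phase of the
sawtooth cascade). "There exist constants `c, C > 0` so that if `M` is sufficiently large then for
every mean-zero `g ∈ H¹` and `j ∈ ℕ` we have the estimates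
`‖g∘Φ_{j+1}⁻¹‖²_{Ḣ¹} + ‖g∘Φ_j‖²_{Ḣ¹} ≥ cK_j⁴‖g‖²_{Ḣ¹}` (16) and
`‖g∘Φ_{j+2}⁻¹‖²_{Ḣ¹} + ‖g∘Φ_{j+2}‖²_{Ḣ¹} ≥ (K_{j+2}⁴ - CK_{j+2}³)‖g‖²_{Ḣ¹}` (17)." Typed over the
unit-torus maps `ElgindiLiss2024.PhiMap/PhiInv` and `K_j = ElgindiLiss2024.growthFactor M j`, with
`‖·‖²_{Ḣ¹} = Torus.eScalarGradNormSq` (the inequalities are homogeneous in the `Ḣ¹` seminorm, so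
the normalisation of the torus is immaterial), `H¹ = MemSobolev 1` of the complexification, `j ≥ 1`.
(Proof p. 11–12: `Q_{k,ℓ}ᵀQ_{k,ℓ}` with entries `S' ∈ {±1}`, `1 ≤ K_{j+1}/K_j ≤ 17`.)
[cite: ElgindiLiss2024, Lemma 2.3 (16)–(17) p. 10] -/
def ElgindiLiss2024_lem23 : Prop :=
  ∃ c C : ℝ, 0 < c ∧ 0 < C ∧ ∃ M₀ : ℝ, ∀ M : ℝ, M₀ ≤ M →
    ∀ g : UnitAddTorus (Fin 2) → ℝ,
      FunctionSpaces.Torus.MemSobolev 1 (fun x => (g x : ℂ)) → FunctionSpaces.Torus.HasZeroMean g →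
      ∀ j : ℕ, 1 ≤ j →
        ENNReal.ofReal (c * ElgindiLiss2024.growthFactor M j ^ 4) * Torus.eScalarGradNormSq g ≤
            Torus.eScalarGradNormSq (g ∘ ElgindiLiss2024.PhiInv M (j + 1)) +
              Torus.eScalarGradNormSq (g ∘ ElgindiLiss2024.PhiMap M j) ∧
        ENNReal.ofReal (ElgindiLiss2024.growthFactor M (j + 2) ^ 4 -
              C * ElgindiLiss2024.growthFactor M (j + 2) ^ 3) * Torus.eScalarGradNormSq g ≤
            Torus.eScalarGradNormSq (g ∘ ElgindiLiss2024.PhiInv M (j + 2)) +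
              Torus.eScalarGradNormSq (g ∘ ElgindiLiss2024.PhiMap M (j + 2))

/-- **Elgindi–Liss 2024, Lemma 2.4** (sharp discrete-time `H¹` growth of EVERY mean-zero `H¹`
datum under the sawtooth cascade). "Let `M` be as defined in Section 2.2.2 and chosen sufficiently
large. For every mean-zero `f₀ ∈ H¹` there exists a constant `c` depending only on an upper bound for
`‖f₀‖_{Ḣ¹}/‖f₀‖_{L²}` such that for every `j ∈ ℕ` the solution of (7) satisfies
`‖f_j‖_{Ḣ¹} ≥ c‖f₀‖_{Ḣ¹}∏_{n=1}^{j}K_n²`", `f_j = f(T_j) = f₀ ∘ Φ_1⁻¹ ∘ ⋯ ∘ Φ_j⁻¹` (p. 9). Typed in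
squared form over `ElgindiLiss2024.flowInv` (`f_j = f₀ ∘ flowInv M j`): for `M ≥ M₀` and every ratio
class `‖∇f₀‖²_{L²} ≤ R‖f₀‖²_{L²}` one `c > 0` (allowed to depend on `M` and `R`, module docstring 7.)
with `c (∏_{n=1}^{j}K_n⁴) ‖f₀‖²_{Ḣ¹} ≤ ‖f₀ ∘ flowInv M j‖²_{Ḣ¹}` for all `j ≥ 1`. This is the
datum-by-datum `K_j²`-per-phase growth law behind Thm. 1 (with Prop. 2.1).
[cite: ElgindiLiss2024, Lemma 2.4 p. 12; proof pp. 12–13] -/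
def ElgindiLiss2024_lem24 : Prop :=
  ∃ M₀ : ℝ, ∀ M : ℝ, M₀ ≤ M → ∀ R : ℝ≥0, ∃ c : ℝ, 0 < c ∧
    ∀ f₀ : UnitAddTorus (Fin 2) → ℝ,
      FunctionSpaces.Torus.MemSobolev 1 (fun x => (f₀ x : ℂ)) →
      FunctionSpaces.Torus.HasZeroMean f₀ →
      Torus.eScalarGradNormSq f₀ ≤ (R : ℝ≥0∞) * ENNReal.ofReal (Torus.scalarL2Sq f₀) →
      ∀ j : ℕ, 1 ≤ j →
        ENNReal.ofReal (c * ∏ n ∈ Finset.Icc 1 j, ElgindiLiss2024.growthFactor M n ^ 4) *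
            Torus.eScalarGradNormSq f₀ ≤
          Torus.eScalarGradNormSq (f₀ ∘ ElgindiLiss2024.flowInv M j)

end Literature.Analysis.FluidPDE

end
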